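import Summits.QuantumFields.YangMills.Theorems.LuscherReductionTwistedTraceScalingStepUpperModel
import Summits.QuantumFields.YangMills.Theorems.LuscherReductionOneSiteLevelsGnHaar
import Mathlib.MeasureTheory.Integral.Pi
import HarnessLib

/-!
# The transfer step at a small-action configuration DOMINATES the Gaussian model integral on the chart ball
# (covariant programme, brick c4(iii)-step V: the LOWER = sub-solution direction, assembled)

Cell `ym-fleet`, crux `TwistedTraceScaling` (stmt-QuantumFields-20203), line «twolattice», stub S-BASE, lane B = COARSE-LOWER(L₁)
(design note `pub/ym-fleet/ym-20203-coarse-s1/LOWER-BLUEPRINT.md` §5–§6, c4; doors `Lower.integral_sq_mul_transferApply_ge`,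
`Avg.physAvg_subsolution_remainder`).  HONEST FRAMING: fixed-lattice bookkeeping; a stub of a child of the CONDITIONAL reduction route (femto
rung R2b1); not a gap, not Clay.

Companion of `…StepUpperModel`: for `β ≥ 0`, measurable `0 ≤ Φ ≤ C`, `S(U) ≤ σ ≤ 1/16`, `δ ≤ 1` (`δ < 1`), `0 ≤ ρ ≤ 1/100` with
`(1−δ)²(1+ρ²) ≤ 1` (so every chart step in the `ρ`-ball is NEAR):

* `integrable_gnoWeight`, `integrable_latGnDensityReal` — the gnomonic Haar density is integrable (finite measure, `GnHaar.isFiniteMeasure_gnoDensityMeasure`,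
  product over links `Integrable.fintype_prod`); `integrable_nearIntegrand` — the near part's chart integrand is integrable;
* `lowerModel` — `x ↦ 𝟙_{ball}(x) e^{−β‖x‖²} e^{−(β/2)‖F(U) + D_U x‖²} Φ(P(x)·U)`;
* ★★ `model_le_transferApply` —
  `((2π²)⁻¹(1+ρ²)⁻²)^{|E|} e^{2β|E|} e^{−(β/2)(η₂+θ)} e^{−(β/2)S(U)} ∫_{LinkSpace} lowerModel ≤ (K_β Φ)(U)`,
  `η₂ = stepErrUp ρ σ N`, `θ = chartErr ρ σ N` (near part only; `…StepNearFar` + `…StepKernelModel` lower kernel bound + density floor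
  `GnChart.latGnDensityReal_ge_of_ball`).

## References
* M. Lüscher, Nucl. Phys. B219 (1983) 233, §3. [Luscher1983]
* E. Seiler, LNP 159 (1982), §3. [SeilerLNP1982]
-/

noncomputable section

open MeasureTheory Real
open Literature.MathematicalPhysics.QuantumFieldTheory
open Literature.MathematicalPhysics.QuantumLattice
open Literature.MathematicalPhysics.QuantumFieldTheory.Balaban1983to89.T4CubeChartGnomonic (gnoWeight gnoWeight_pos measurable_gnoWeight)

namespace Summit.QuantumFields.YangMills.Theorems.FemtoTransferGap.TwoLattice.Cov

open Summit.QuantumFields.YangMills.Theorems.FemtoTransferGap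
open Summit.QuantumFields.YangMills.Theorems.FemtoTransferGap.TwoLattice
open Summit.QuantumFields.YangMills.Theorems.FemtoTransferGap.TwoLattice.Stiff
open Summit.QuantumFields.YangMills.Theorems.FemtoTransferGap.TwoLattice.GnChart

variable {L : ℕ} [NeZero L]

/-! ## §1 Integrability of the gnomonic density and of the near integrand -/

omit [NeZero L] in
/-- The one-link gnomonic Haar weight `w(v) = (2π²)⁻¹(1+|v|²)⁻²` is integrable on `ℝ³`. [folklore] -/
theorem integrable_gnoWeight : Integrable gnoWeight (volume : Measure (Fin 3 → ℝ)) := by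
  have hfin := isFiniteMeasure_gnoDensityMeasure
  have h : ∫⁻ v, ENNReal.ofReal (gnoWeight v) ∂(volume : Measure (Fin 3 → ℝ)) < ⊤ := by
    have := measure_lt_top gnoDensityMeasure Set.univ
    rwa [gnoDensityMeasure, withDensity_apply _ MeasurableSet.univ, Measure.restrict_univ] at this
  refine ⟨measurable_gnoWeight.aestronglyMeasurable, ?_⟩
  rw [hasFiniteIntegral_iff_ofReal (ae_of_all _ fun v => (gnoWeight_pos v).le)]
  exact h

/-- The lattice gnomonic density `∏_e w(y_e)` is integrable on `(E → ℝ³)`. [folklore] -/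
theorem integrable_latGnDensityReal : Integrable (latGnDensityReal L) (volume : Measure (Edge 3 L → Fin 3 → ℝ)) := by
  have h := Integrable.fintype_prod (ι := Edge 3 L) (f := fun (_ : Edge 3 L) (v : Fin 3 → ℝ) => gnoWeight v)
    (μ := fun _ => volume) fun _ => integrable_gnoWeight
  exact h

/-- The near integrand in the chart is integrable: density (integrable) times a bounded measurable factor. [folklore] -/
theorem integrable_nearIntegrand (β δ : ℝ) {Φ : GaugeConfig 3 L SU2 → ℝ} (hΦ : Measurable Φ) {C : ℝ} (hC : ∀ V, |Φ V| ≤ C)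
    (U : GaugeConfig 3 L SU2) :
    Integrable (fun y : Edge 3 L → Fin 3 → ℝ => latGnDensityReal L y *
      (nearInd δ (latPatternChart L (fun _ => false) y) * stepIntegrand β Φ U (latPatternChart L (fun _ => false) y))) := by
  obtain ⟨B, hB⟩ := exists_abs_stepIntegrand_le β hC U
  have hm : Measurable fun y : Edge 3 L → Fin 3 → ℝ =>
      nearInd δ (latPatternChart L (fun _ => false) y) * stepIntegrand β Φ U (latPatternChart L (fun _ => false) y) :=
    ((measurable_nearInd δ).comp (measurable_latPatternChart L _)).mul
      ((measurable_stepIntegrand β hΦ U).comp (measurable_latPatternChart L _))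
  have hbound : ∀ᵐ y : Edge 3 L → Fin 3 → ℝ ∂volume,
      ‖nearInd δ (latPatternChart L (fun _ => false) y) * stepIntegrand β Φ U (latPatternChart L (fun _ => false) y)‖ ≤ B :=
    ae_of_all _ fun y => by
      rw [Real.norm_eq_abs, abs_mul]
      have := (abs_nearInd_le δ (latPatternChart L (fun _ => false) y)).1
      have hB0 : 0 ≤ B := (abs_nonneg _).trans (hB 1)
      nlinarith [hB (latPatternChart L (fun _ => false) y), abs_nonneg (stepIntegrand β Φ U (latPatternChart L (fun _ => false) y)),
        abs_nonneg (nearInd δ (latPatternChart L (fun _ => false) y))]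
  have h := (integrable_latGnDensityReal (L := L)).bdd_mul hm.aestronglyMeasurable hbound
  simpa only [mul_comm] using h

/-! ## §2 The lower model integrand -/

/-- The LOWER model integrand at `U`: `x ↦ 𝟙_{ball}(x) · e^{−β‖x‖²} · e^{−(β/2)‖F(U) + D_U x‖²} · Φ(P(x)·U)`. [cite: Luscher1983, §3] -/
def lowerModel (β ρ : ℝ) (Φ : GaugeConfig 3 L SU2 → ℝ) (U : GaugeConfig 3 L SU2) (x : LinkSpace L) : ℝ :=
  (chartBall L ρ).indicator
    (fun x => Real.exp (-(β * ‖x‖ ^ 2)) * Real.exp (-(β / 2) * ‖plaqCurv U + covCurl U x‖ ^ 2) *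
      Φ (latPatternChart L (fun _ => false) (linkCurry x) * U)) x

/-- The lower model integrand is non-negative for `Φ ≥ 0`. [folklore] -/
theorem lowerModel_nonneg (β ρ : ℝ) {Φ : GaugeConfig 3 L SU2 → ℝ} (hΦ0 : ∀ V, 0 ≤ Φ V) (U : GaugeConfig 3 L SU2) (x : LinkSpace L) :
    0 ≤ lowerModel β ρ Φ U x := by
  unfold lowerModel
  by_cases hx : x ∈ chartBall L ρ
  · rw [Set.indicator_of_mem hx]; exact mul_nonneg (by positivity) (hΦ0 _)
  · rw [Set.indicator_of_notMem hx]

/-- The exponent bookkeeping of the lower kernel bound: `e^{−(β/2)(S + (g + η + θ))} = e^{−(β/2)(η+θ)} e^{−(β/2)S} e^{−(β/2)g}`. [folklore] -/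
theorem exp_lower_split (β S g η θ : ℝ) :
    Real.exp (-(β / 2) * (S + (g + η + θ))) = Real.exp (-(β / 2) * (η + θ)) * Real.exp (-(β / 2) * S) * Real.exp (-(β / 2) * g) := by
  rw [← Real.exp_add, ← Real.exp_add]; congr 1; ring

/-! ## §3 The model integral is dominated by the step -/

/-- ★★ **THE GAUSSIAN MODEL INTEGRAL ON THE CHART BALL IS DOMINATED BY THE TRANSFER STEP.**  For `β ≥ 0`, measurable `0 ≤ Φ ≤ C`,
`S(U) ≤ σ ≤ 1/16`, `δ < 1`, `0 ≤ ρ ≤ 1/100` with `(1−δ)²(1+ρ²) ≤ 1`: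
`((2π²)⁻¹(1+ρ²)⁻²)^{|E|} e^{2β|E|} e^{−(β/2)(η₂+θ)} e^{−(β/2)S(U)} ∫ lowerModel β ρ Φ U ≤ (K_βΦ)(U)`. [cite: Luscher1983, §3] [cite: SeilerLNP1982, §3] -/
theorem model_le_transferApply {β δ ρ σ : ℝ} (hβ : 0 ≤ β) (hδ : δ < 1) (hρ0 : 0 ≤ ρ) (hρ : ρ ≤ 1 / 100)
    (hρδ : (1 - δ) ^ 2 * (1 + ρ ^ 2) ≤ 1) (hσ : σ ≤ 1 / 16) {Φ : GaugeConfig 3 L SU2 → ℝ} (hΦ : Measurable Φ) (hΦ0 : ∀ V, 0 ≤ Φ V)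
    {C : ℝ} (hC : ∀ V, Φ V ≤ C) (U : GaugeConfig 3 L SU2) (hS : wilsonAction su2Rep U ≤ σ) :
    ((2 * π ^ 2)⁻¹ * ((1 + ρ ^ 2)⁻¹) ^ 2) ^ Fintype.card (Edge 3 L) * Real.exp (2 * β) ^ Fintype.card (Edge 3 L) *
        Real.exp (-(β / 2) * (stepErrUp ρ σ (Fintype.card (Plaquette 3 L × Fin 3)) + chartErr ρ σ (Fintype.card (Plaquette 3 L × Fin 3)))) *
        Real.exp (-(β / 2) * wilsonAction su2Rep U) * (∫ x, lowerModel β ρ Φ U x) ≤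
      transferApply β Φ U := by
  have hC' : ∀ V, |Φ V| ≤ C := fun V => abs_le.mpr ⟨by linarith [hΦ0 V, hΦ0 1, hC 1], hC V⟩
  obtain ⟨hlow, -⟩ := transferApply_near_sandwich hβ δ hΦ hΦ0 hC U
  refine le_trans ?_ hlow
  rw [near_integral_eq_chart β hδ hΦ hC' U]
  set N : ℝ := (Fintype.card (Plaquette 3 L × Fin 3) : ℝ)
  set K : ℝ := ((2 * π ^ 2)⁻¹ * ((1 + ρ ^ 2)⁻¹) ^ 2) ^ Fintype.card (Edge 3 L) * Real.exp (2 * β) ^ Fintype.card (Edge 3 L) *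
    Real.exp (-(β / 2) * (stepErrUp ρ σ N + chartErr ρ σ N)) * Real.exp (-(β / 2) * wilsonAction su2Rep U) with hK
  have hK0 : 0 ≤ K := by positivity
  have htrans : K * ∫ x, lowerModel β ρ Φ U x = ∫ y : Edge 3 L → Fin 3 → ℝ, K * lowerModel β ρ Φ U (chartVec y) := by
    rw [integral_const_mul, integral_comp_chartVec]
  rw [htrans]
  refine integral_mono_of_nonneg (ae_of_all _ fun y => mul_nonneg hK0 (lowerModel_nonneg β ρ hΦ0 U _))
    (integrable_nearIntegrand β δ hΦ hC' U) (ae_of_all _ fun y => ?_)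
  show K * lowerModel β ρ Φ U (chartVec y) ≤ latGnDensityReal L y *
    (nearInd δ (latPatternChart L (fun _ => false) y) * stepIntegrand β Φ U (latPatternChart L (fun _ => false) y))
  by_cases hball : chartVec y ∈ chartBall L ρ
  · have hy : ∀ e, ∑ a, y e a ^ 2 ≤ ρ ^ 2 := (chartVec_mem_chartBall_iff ρ y).mp hball
    have hnear : latPatternChart L (fun _ => false) y ∈ nearSet δ := mem_nearSet_chart_of_sum_sq_le hδ.le hρδ hy
    rw [nearInd_of_mem hnear, one_mul, lowerModel, Set.indicator_of_mem hball, linkCurry_chartVec, stepIntegrand]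
    obtain ⟨hk, -⟩ := transferKernel_step_model_sandwich U y hβ hρ0 hρ hσ hS hy
    have hdens := latGnDensityReal_ge_of_ball L y hy
    have hΦy := hΦ0 (latPatternChart L (fun _ => false) y * U)
    rw [exp_lower_split] at hk
    calc K * (Real.exp (-(β * ‖chartVec y‖ ^ 2)) * Real.exp (-(β / 2) * ‖plaqCurv U + covCurl U (chartVec y)‖ ^ 2) *
          Φ (latPatternChart L (fun _ => false) y * U))
        = ((2 * π ^ 2)⁻¹ * ((1 + ρ ^ 2)⁻¹) ^ 2) ^ Fintype.card (Edge 3 L) *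
            ((Real.exp (2 * β) ^ Fintype.card (Edge 3 L) * Real.exp (-(β * ‖chartVec y‖ ^ 2)) *
              (Real.exp (-(β / 2) * (stepErrUp ρ σ N + chartErr ρ σ N)) * Real.exp (-(β / 2) * wilsonAction su2Rep U) *
                Real.exp (-(β / 2) * ‖plaqCurv U + covCurl U (chartVec y)‖ ^ 2))) *
            Φ (latPatternChart L (fun _ => false) y * U)) := by rw [hK]; ring
      _ ≤ latGnDensityReal L y * (transferKernel su2Rep β U (latPatternChart L (fun _ => false) y * U) *
            Φ (latPatternChart L (fun _ => false) y * U)) :=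
          mul_le_mul hdens (mul_le_mul_of_nonneg_right hk hΦy) (mul_nonneg (by positivity) hΦy) (latGnDensityReal_pos_le L y).1.le
  · rw [lowerModel, Set.indicator_of_notMem hball, mul_zero]
    exact mul_nonneg (latGnDensityReal_pos_le L y).1.le (mul_nonneg (nearInd_mem_Icc δ _).1
      (mul_nonneg (transferKernel_pos su2Rep β U _).le (hΦ0 _)))

end Summit.QuantumFields.YangMills.Theorems.FemtoTransferGap.TwoLattice.Cov

end
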